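import Mathlib
import Literature.Analysis.UnboundedOperators.LinearizedBoltzmann
import Literature.Analysis.UnboundedOperators.LinearizedBoltzmannDirichletFormProofs
import Summits.AtomisticToContinuum.HydrodynamicLimit.Theses.AntiMazurCoboundaries

/-!
# Sketch — crux `KineticFluxLdDecay` (stmt-AtomisticToContinuum-10967), crux-ideate round 2, ideator 4

Idea `h-theorem-dissipation-budget`: the H-theorem as the rate mechanism.

* `gain_sq_le_dirichletFormInv_mul_dissipation` — FIRST LEMMA (kinetic side, PROVED here from tree
  facts): for a fast observable `A ⊥ collisionInvariants` and any test distortion `χ`,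
  `⟪A, χ⟫_M² ≤ ⟪A, (-L)⁻¹A⟫_M · (−⟪χ, Lχ⟫_M)` — the instantaneous gain of a fast one-body observable is
  dominated by the Green–Kubo/Chapman–Enskog coefficient `dirichletFormInv L A` times the linearised
  entropy production of the distortion. (Immediate from the VARIATIONAL definition of
  `dirichletFormInv` and the proved `bddAbove_range_dirichlet_of_orthogonal_holds`.)
* `BudgetTransfer` — the abstract Donsker–Varadhan + Cauchy–Schwarz-in-time step (typed; provable now, M).
* `oneBodyLaw`, `entropyProduction`, `hellingerProduction`, `NoPerpetualDissipation` — the typed transfer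
  target `C⁺` (the bet), stated with the HELLINGER entropy production (the log form is false in caricature).
-/

noncomputable section

open MeasureTheory
open scoped ENNReal

namespace Summit.AtomisticToContinuum.HydrodynamicLimit.Cruxes.KineticFluxLdDecay.IdeatorFour

/-! ## § 1 Kinetic side: gain–dissipation duality (first lemma, proved) -/

section Kinetic

open Literature.Analysis.UnboundedOperators

variable {E : Type*} [NormedAddCommGroup E] [InnerProductSpace ℝ E] [FiniteDimensional ℝ E]
  [MeasurableSpace E] [BorelSpace E]

/-- **Gain–dissipation duality** (first lemma of the line; provable now and proved here).
For `A` of temperate growth `M`-orthogonal to the collision invariants and any `χ` of temperate growth,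
`⟪A, χ⟫_M ^ 2 ≤ dirichletFormInv L A * (−⟪χ, L χ⟫_M)`, `L` the linearised hard-sphere operator.
Proof: the variational family `t ↦ 2⟪A, tχ⟫ + ⟪tχ, L(tχ)⟫ = 2ta − t²b` is bounded by
`dirichletFormInv L A` (definition as an `iSup` + `bddAbove_range_dirichlet_of_orthogonal_holds`);
optimise in `t`. -/
theorem gain_sq_le_dirichletFormInv_mul_dissipation (hE : 2 ≤ Module.finrank ℝ E)
    {A χ : E → ℝ} (hA : A ∈ temperateGrowth E) (hχ : χ ∈ temperateGrowth E)
    (horth : ∀ φ ∈ collisionInvariants E, maxwellianInner A φ = 0) :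
    (maxwellianInner A χ) ^ 2 ≤
      dirichletFormInv hardSphereLinearizedOp A *
        (-maxwellianInner χ (hardSphereLinearizedOp χ)) := by
  set a : ℝ := maxwellianInner A χ with ha_def
  set b : ℝ := -maxwellianInner χ (hardSphereLinearizedOp χ) with hb_def
  set D : ℝ := dirichletFormInv hardSphereLinearizedOp A with hD_def
  have hb : 0 ≤ b := by
    have h := maxwellianInner_hardSphereLinearizedOp_self_nonpos_holds (E := E) hχ
    simp only [hb_def]
    linarith
  -- the variational family evaluated at `t • χ`
  have hfam : ∀ t : ℝ, 2 * (t * a) - t ^ 2 * b ≤ D := by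
    intro t
    have hmem : (fun v => t * χ v) ∈ temperateGrowth E := by
      have := (temperateGrowth E).smul_mem t hχ
      simpa [Pi.smul_def, smul_eq_mul] using this
    have key : 2 * maxwellianInner A (fun v => t * χ v) +
        maxwellianInner (fun v => t * χ v) (hardSphereLinearizedOp (fun v => t * χ v)) ≤ D := by
      have := le_ciSup (bddAbove_range_dirichlet_of_orthogonal_holds hE hA horth)
        ⟨fun v => t * χ v, hmem⟩
      simpa [hD_def, dirichletFormInv] using this
    have h1 : maxwellianInner A (fun v => t * χ v) = t * a := by
      rw [maxwellianInner_const_mul_right]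
    have h2 : maxwellianInner (fun v => t * χ v) (hardSphereLinearizedOp (fun v => t * χ v)) =
        -(t ^ 2 * b) := by
      rw [hardSphereLinearizedOp_const_mul, maxwellianInner_const_mul_left,
        maxwellianInner_const_mul_right]
      simp only [hb_def]
      ring
    rw [h1, h2] at key
    linarith
  by_cases hb0 : b = 0
  · -- degenerate dissipation forces zero gain
    have ha0 : a = 0 := by
      by_contra ha
      have h := hfam ((D + 1) / (2 * a))
      rw [hb0] at h
      have : 2 * ((D + 1) / (2 * a) * a) = D + 1 := by
        field_simp
      linarith
    simp [ha0, hb0]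
  · have hbpos : 0 < b := lt_of_le_of_ne hb (Ne.symm hb0)
    have h := hfam (a / b)
    have : 2 * (a / b * a) - (a / b) ^ 2 * b = a ^ 2 / b := by
      field_simp
      ring
    rw [this] at h
    rw [div_le_iff₀ hbpos] at h
    linarith

end Kinetic

/-! ## § 2 The abstract transfer: entropy budget ⇒ window pressure (Donsker–Varadhan + Cauchy–Schwarz) -/

/-- **Budget-to-pressure transfer** (typed; provable now, size M). If every probability `ν ≪ μ` of
finite relative entropy gains at most `√(A·n·(H(ν|μ) + B n)/h) + θ·H(ν|μ)` on the functional `X`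
(`θ < 1` the local-equilibrium allowance, `n` the particle number, `h` the window in kinetic units),
then the pressure of `X` is `≤ n·(A/(4(1−θ)h) + √(AB/h))` — Donsker–Varadhan
`log ∫ e^X dμ = sup_ν (E_ν X − H(ν|μ))` and `sup_s (√(A(s+B)/h) + θ s − s) ≤ A/(4(1−θ)h) + √(AB/h)`. -/
def BudgetTransfer : Prop :=
  ∀ (Ω : Type) [MeasurableSpace Ω] (μ : Measure Ω), IsProbabilityMeasure μ →
    ∀ (X : Ω → ℝ), Measurable X → (∃ C : ℝ, ∀ ω, |X ω| ≤ C) →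
    ∀ (n A B h θ : ℝ), 0 < n → 0 ≤ A → 0 ≤ B → 0 < h → 0 ≤ θ → θ < 1 →
    (∀ ν : Measure Ω, IsProbabilityMeasure ν → ν ≪ μ → InformationTheory.klDiv ν μ ≠ ⊤ →
      ∫ ω, X ω ∂ν ≤ Real.sqrt (A * n * ((InformationTheory.klDiv ν μ).toReal + B * n) / h)
        + θ * (InformationTheory.klDiv ν μ).toReal) →
    Real.log (∫ ω, Real.exp (X ω) ∂μ) ≤ n * (A / (4 * (1 - θ) * h) + Real.sqrt (A * B / h))

/-! ## § 3 The transfer target `C⁺`: NO PERPETUAL DISSIPATION (typed; the bet) -/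

section NBody

open Literature.Analysis.FluidPDE Literature.MathematicalPhysics.KineticTheory

/-- The hard-sphere flows of the crux. -/
abbrev Flow (σ : ℝ) (N : ℕ) : Type :=
  HardSphereFlow (Torus.geometry (Fin 3)) (hsDiameter σ N) (N + 1)

/-- Phase space of the crux. -/
abbrev Phase (N : ℕ) : Type := Config (N + 1) (Fin 3) T3

/-- The homogeneous Gibbs law `G_N` of the crux. -/
abbrev gibbs (σ a θ : ℝ) (u₀ : V3) (N : ℕ) (Φ : Flow σ N) : Measure (Phase N) :=
  localGibbsLaw σ (fun _ => a) (fun _ => u₀) (fun _ => θ) N Φ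

/-- The (normalised) ONE-BODY LAW at time `t` of an initial law `ν` under the flow `Φ`:
`f_t = (N+1)⁻¹ Σ_i Law_ν (x_i(t), v_i(t))`, a sub-probability/probability measure on `𝕋³ × ℝ³`. -/
def oneBodyLaw {σ : ℝ} {N : ℕ} (Φ : Flow σ N) (ν : Measure (Phase N)) (t : ℝ) : Measure (T3 × V3) :=
  (((N + 1 : ℕ) : ℝ≥0∞)⁻¹) • ∑ i : Fin (N + 1), ν.map (fun z => Φ.flow t z i)

/-- Boltzmann's ENTROPY-PRODUCTION functional of a one-body density `ρ` on `𝕋³ × ℝ³` (hard-sphere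
kernel, unit diameter and unit number density — kinetic units):
`D(ρ) = ¼ ∫dx ∫∫∫ ((v−w)·ω)₊ (ρ'ρ'_* − ρρ_*) log(ρ'ρ'_*/(ρρ_*)) dω dw dv ≥ 0`, `= 0` iff `ρ(x,·)` is a local
Maxwellian for a.e. `x` (Boltzmann's H-theorem). Junk-tolerant (`Real.log`, Bochner). NOT the functional of
`C⁺` (its log-singularity at velocity vacua makes the budget inequality false already in Markov caricatures:
conditioning a chain to sit at one state has finite path entropy and infinite log-dissipation); recorded for
comparison: `hellingerProduction ρ ≤ entropyProduction ρ` pointwise in the integrand, by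
`(a − b) log(a/b) ≥ 4 (√a − √b)²`. -/
def entropyProduction (ρ : T3 × V3 → ℝ) : ℝ :=
  (1 / 4) * ∫ x : T3, ∫ v : V3, ∫ w : V3, ∫ ω,
    hardSphereKernel (v, w) ω *
      ((ρ (x, (collide ω (v, w)).1) * ρ (x, (collide ω (v, w)).2) - ρ (x, v) * ρ (x, w)) *
        Real.log ((ρ (x, (collide ω (v, w)).1) * ρ (x, (collide ω (v, w)).2)) /
          (ρ (x, v) * ρ (x, w)))) ∂sphereMeasure

/-- The HELLINGER ENTROPY PRODUCTION of a one-body density `ρ` (the functional of `C⁺`):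
`𝒟_H(ρ) = ∫dx ∫∫∫ ((v−w)·ω)₊ (√(ρ'ρ'_*) − √(ρρ_*))² dω dw dv`. It is `≤ D(ρ)`, bounded by twice the
collision rate (no log-singularity), vanishes exactly on local Maxwellians, and agrees with the linearised
Dirichlet form `−⟪χ, Lχ⟫_M` to second order at `ρ = M(1 + χ)` — which is all the gain–dissipation duality
of § 1 consumes. -/
def hellingerProduction (ρ : T3 × V3 → ℝ) : ℝ :=
  ∫ x : T3, ∫ v : V3, ∫ w : V3, ∫ ω,
    hardSphereKernel (v, w) ω *
      (Real.sqrt (ρ (x, (collide ω (v, w)).1) * ρ (x, (collide ω (v, w)).2)) -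
        Real.sqrt (ρ (x, v) * ρ (x, w))) ^ 2 ∂sphereMeasure

/-- The one-body density at time `t` (Radon–Nikodym derivative of the one-body law w.r.t. Lebesgue). -/
def oneBodyDensity {σ : ℝ} {N : ℕ} (Φ : Flow σ N) (ν : Measure (Phase N)) (t : ℝ) : T3 × V3 → ℝ :=
  fun y => ((oneBodyLaw Φ ν t).rnDeriv volume y).toReal

/-- **`C⁺` = NO PERPETUAL DISSIPATION** (the transfer target; the bet). In the crux's frame and units
(`N+1` spheres of diameter `σ(N+1)^{-1/3}` on `𝕋³`, so the per-particle collision-rate prefactor is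
`(N+1)·d_N² = σ²(N+1)^{1/3}` and a kinetic window is `h = τ(N+1)^{-1/3}`): there are constants `A', B`
(depending on `σ, a, θ` only) such that for every kinetic window `τ`, all large `N`, every flow and EVERY
initial probability law `ν ≪ G_N` of finite relative entropy, the time-integrated Boltzmann entropy
production (Hellinger form) of the one-body law along the `N`-body flow is budgeted by the `N`-body relative entropy:
`(N+1) · σ²(N+1)^{1/3} · ∫₀^{τ(N+1)^{-1/3}} 𝒟_H(f_t^ν) dt ≤ A' · H(ν | G_N) + B · (N+1)`.
True with `A' = 1, B = 0` if `f_t` solved the Boltzmann equation from a chaotic datum (H-theorem, `𝒟_H ≤ D`);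
true with the SHARP constant `A' = 4` in every reversible Markov caricature (Föllmer's forward/backward
Girsanov representation of path entropy + the osmotic identity `b̄ + b̄⃖ = 2∇log f_t`; numerically `sup = 4`
for jump caricatures, toy/exchange_rate*.py); the time-symmetric Gibbs–Feynman–Kac tilt — the crux's own
optimal enemy — saturates it, so `A' ≥ 4` is necessary. -/
def NoPerpetualDissipation : Prop :=
  ∀ (a θ : ℝ) (u₀ : V3), 0 < a → 0 < θ → ∃ σ₀ : ℝ, 0 < σ₀ ∧ ∀ σ : ℝ, 0 < σ → σ < σ₀ →
    ∃ A' B : ℝ, 0 ≤ A' ∧ 0 ≤ B ∧ ∀ τ : ℝ, 0 < τ → ∃ N₀ : ℕ, ∀ N : ℕ, N₀ ≤ N →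
      ∀ (Φ : Flow σ N) (ν : Measure (Phase N)), IsProbabilityMeasure ν →
        ν ≪ gibbs σ a θ u₀ N Φ → InformationTheory.klDiv ν (gibbs σ a θ u₀ N Φ) ≠ ⊤ →
        ((N + 1 : ℕ) : ℝ) * (σ ^ 2 * ((N + 1 : ℕ) : ℝ) ^ (1 / 3 : ℝ)) *
            ∫ t in (0 : ℝ)..(τ * ((N + 1 : ℕ) : ℝ) ^ (-(1 / 3 : ℝ))),
              hellingerProduction (oneBodyDensity Φ ν t)
          ≤ A' * (InformationTheory.klDiv ν (gibbs σ a θ u₀ N Φ)).toReal + B * ((N + 1 : ℕ) : ℝ)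

end NBody

end Summit.AtomisticToContinuum.HydrodynamicLimit.Cruxes.KineticFluxLdDecay.IdeatorFour
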